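import Literature.NumberTheory.GaloisCohomology.Howard2004.SelmerTriples
import Literature.NumberTheory.GaloisRepresentations.AbsGaloisConjByTransportProofs
import Literature.NumberTheory.GaloisRepresentations.DecompositionGroupOfCompletion
import Literature.NumberTheory.GaloisRepresentations.DecompositionGroupNested
import Literature.NumberTheory.GaloisRepresentations.DecompositionGroupRelSlim
import HarnessLib

/-!
# The INERTIA letters of a conjugation datum: `φ_v` carries `I_{K_v}` onto `I_{K_{σv}}` and is the identity
# modulo inertia at a prime fixed by `σ`, for EVERY `ConjugationDatum` (proofs file)

Topic `NumberTheory/GaloisCohomology/Howard2004` (sequel to `ConjugationDatumDihedralProofs`).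
THEOREMS ONLY: no definition, no named fact, no instance, no notation, no `sorry`.

B. Howard, *The Heegner point Kolyvagin system*, Compositio Math. **140** (2004) = arXiv:1202.6340, §1.3
(p. 7 L44–48): «conjugation by `τ` induces an isomorphism `H^i(K_v̄, T) ≅ H^i(K_v, Tw(T))`» — the tree's
`ConjugationDatum` records this as transports `φ_v : Γ_{K_v} → Γ_{K_{σv}}` with `res ∘ φ_v = δ_v⁻¹ (τ⁻¹ · τ) δ_v ∘ res`
(`cd.compat`), UP TO the genuine inner ambiguity `δ_v ∈ Γ_K`.  The local proofs of §1.5 (Lemma 1.5.3,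
Prop. 1.5.9) use that this transport is a transport OF LOCAL FIELDS: it maps inertia to inertia and, at a
degree-two prime `λ = λ̄`, acts trivially on `Γ_{K_λ}/I_{K_λ}` (it fixes the Frobenius coset).  In the tree these
are the LETTERS `hI : ∀ g ∈ I_{K_v}, φ_v g ∈ I_{K_{σv}}`, `hφI : ∀ g, ∃ i ∈ I_{K_v}, (σv = v) ▸ φ_v g = i * g`
(`InertStubLocalizationTransferProofs`, `FrobeniusReadoutLagrangianTransferProofs`, `InertLagrangianTransferProofs`,
`InertLocalPairingSymmetricProofs`; S-level binders `hI`/`hφI` of `DVRSettingEngineH159Proofs`) and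
`hφγ : γ₀⁻¹ * ((σq = q) ▸ φ_q γ₀) ∈ I_{K_q}` (`InertEigenlinesProofs`).  This file DISCHARGES them for EVERY
conjugation datum over EVERY number field — unconditionally: the inner ambiguity is resolved by
[NSW] Cor. 12.1.3 «distinct primes of `K̄` have non-commensurable decomposition groups», which the tree holds
(`DecompositionGroupNested.eq_of_decompositionSubgroup_le`), together with Neukirch II (9.6)
`D_{𝔓₀} = res Γ_{K_v}`, `I_{𝔓₀} = res I_{K_v}` (`DecompositionGroupOfCompletion`) and the injectivity of `res`
(`DecompositionGroupRelSlim`).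

Write `σ̃_v := τ ∘ δ_v : K̄ ≃+* K̄` (a lift of `σ`), `f_v := absGalConjBy σ̃_v σ _ : Γ_K →* Γ_K` (`g ↦ σ̃_v⁻¹ g σ̃_v`),
`𝔓_v := adicCompletionPrime K v` (the prime of `\bar ℤ_K` cut out by `K̄ → \bar K_v`).
* §1 `ConjugationDatum.conjLift_algebraMap` (`σ̃_v` lifts `σ`), **`absGaloisRestrict_φ_eq_absGalConjBy`**
  (`res (φ_v g) = f_v (res g)` — `cd.compat` read through `absGalConjBy`), `range_absGaloisRestrict_smul_eq_map`
  (`res Γ_{K_{σv}} = f_v (res Γ_{K_v})`), `decompositionSubgroup_adicCompletionPrime_smul_eq_map`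
  (`D_{𝔓_{σv}} = f_v(D_{𝔓_v})`).
* §2 **`mem_adicCompletionPrime_smul_iff`** — `x ∈ 𝔓_{σv} ↔ σ̃_v x ∈ 𝔓_v`, i.e. `𝔓_{σv} = σ̃_v⁻¹ 𝔓_v`
  ([NSW] 12.1.3: `D_{𝔓_{σv}} = f_v D_{𝔓_v} ≤ D_{σ̃_v⁻¹𝔓_v}`); `inertia_adicCompletionPrime_smul_eq_map`
  (`I_{𝔓_{σv}} = f_v(I_{𝔓_v})`); **`map_φ_absInertia_eq`** (`φ_v(I_{K_v}) = I_{K_{σv}}`) and the letter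
  **`φ_mem_absInertia`** (`hI`), with `φ_mem_absInertia_iff`.
* §3 (a place with `h : σ • v = v`): `mem_adicCompletionPrime_iff_of_smul_eq` (`σ̃_v` FIXES `𝔓_v`),
  **`φ_cast_mul_inv_mem_absInertia`** (`(h ▸ φ_v g) * g⁻¹ ∈ I_{K_v}`), the letter **`exists_mem_absInertia_φ_cast_eq`**
  (`hφI`: `∃ i ∈ I_{K_v}, (h ▸ φ_v g) = i * g`) and **`inv_mul_φ_cast_mem_absInertia`** (`hφγ`:
  `g⁻¹ * (h ▸ φ_v g) ∈ I_{K_v}`), from `AbsGaloisConjByTransportProofs` §3 (conjugation by `σ̃_v` is the identity on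
  `D_{𝔓_v}/I_{𝔓_v}`: the induced automorphisms of the residue field `κ(𝔓_v) ⊂ 𝔽̄_ℓ` commute).

Cell `pub/bsd-print-x9`, G87 = Howard 2004 Thm. 1.6.1 (print leaf `stub_h161` of stmt-BirchSwinnertonDyer-22642);
seat `bsd-line-x10b-p1-w5` g9, brick (DATUM-GEN) part 2.  NOT HERE: the pairing letter `hδ`; the S-level
one-liners (next file); `thm161_dvrKolyvaginBound` is NOT proved; no summit statement is proved; BSD is not
proved by any of this.

References: [Howard2004HeegnerKolyvagin] §1.3 (arXiv p. 7 L44–48), Lemma 1.5.3 / Prop. 1.5.9 (p. 10);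
[NeukirchSchmidtWingberg2008] Cor. 12.1.3; [NeukirchANT1999] Ch. I §9 (9.4)–(9.6), Ch. II §9 Prop. (9.6);
[SerreLocalFields1979] Ch. I §7–§8.
-/

set_option autoImplicit false

noncomputable section

open scoped Pointwise NumberField
open NumberField IsDedekindDomain Field

namespace Literature.NumberTheory.GaloisCohomology.Howard2004

open Literature.NumberTheory.GaloisRepresentations
open Literature.NumberTheory.NumberFields
open Literature.NumberTheory.EllipticCurves

variable {K : Type} [Field K] [NumberField K]

/-- Restriction to `K̄` commutes with the transport of a local Galois element along an equality of places
`e : v = w`. (Private copy of `absGaloisRestrict_cast_eq` of `ConjugationDatumDihedralProofs`, to keep the imports of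
this file small.) [cite: Howard2004HeegnerKolyvagin, §1.3 (arXiv p. 7 L44–48)] -/
private theorem absGaloisRestrict_cast_eq' {v w : HeightOneSpectrum (𝓞 K)} (e : v = w)
    (x : absoluteGaloisGroup (v.adicCompletion K)) :
    absGaloisRestrict K (w.adicCompletion K) (e ▸ x : absoluteGaloisGroup (w.adicCompletion K)) =
      absGaloisRestrict K (v.adicCompletion K) x := by
  subst e
  rfl

/-- The image of the restriction map does not depend on the name of the place: for `e : v = w`,
`res Γ_{K_w} = res Γ_{K_v}`. [cite: NeukirchANT1999, Ch. II §9 Prop. (9.6)] -/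
private theorem range_absGaloisRestrict_eq_of_eq {v w : HeightOneSpectrum (𝓞 K)} (e : v = w) :
    (absGaloisRestrict K (w.adicCompletion K)).toMonoidHom.range =
      (absGaloisRestrict K (v.adicCompletion K)).toMonoidHom.range := by
  subst e
  rfl

namespace ConjugationDatum

/-! ## §1 `σ̃_v = τ ∘ δ_v` and `res ∘ φ_v = (σ̃_v⁻¹ · σ̃_v) ∘ res` -/

/-- **`σ̃_v := τ ∘ δ_v` lifts `σ`**: `τ (δ_v (ι k)) = ι (σ k)` (`δ_v ∈ Γ_K` fixes `K`, `τ` lifts `σ`).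
[cite: Howard2004HeegnerKolyvagin, §1.3 (arXiv p. 7 L33–48)] -/
theorem conjLift_algebraMap (cd : ConjugationDatum K) (v : HeightOneSpectrum (𝓞 K)) (k : K) :
    (((absoluteGaloisGroup.toAlgEquiv K (cd.δ v)).toRingEquiv.trans cd.τ)
        (algebraMap K (AlgebraicClosure K) k)) =
      algebraMap K (AlgebraicClosure K) ((cd.σ : K ≃+* K) k) := by
  change cd.τ ((absoluteGaloisGroup.toAlgEquiv K (cd.δ v)) (algebraMap K (AlgebraicClosure K) k)) = _
  rw [AlgEquiv.commutes, cd.isLift k]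
  rfl

/-- **`res (φ_v g) = σ̃_v⁻¹ (res g) σ̃_v`**: the compatibility `cd.compat` of the datum, read through the conjugation
homomorphism `absGalConjBy σ̃_v σ _` of `AbsGaloisConjBy` (`δ_v⁻¹ (τ⁻¹ r τ) δ_v = σ̃_v⁻¹ r σ̃_v`).
[cite: Howard2004HeegnerKolyvagin, §1.3 (arXiv p. 7 L44–48)] -/
theorem absGaloisRestrict_φ_eq_absGalConjBy (cd : ConjugationDatum K) (v : HeightOneSpectrum (𝓞 K))
    (g : absoluteGaloisGroup (v.adicCompletion K)) :
    absGaloisRestrict K ((cd.σ • v).adicCompletion K) (cd.φ v g) =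
      absGalConjBy ((absoluteGaloisGroup.toAlgEquiv K (cd.δ v)).toRingEquiv.trans cd.τ) (cd.σ : K ≃+* K)
        (cd.conjLift_algebraMap v) (absGaloisRestrict K (v.adicCompletion K) g) := by
  rw [cd.compat]
  apply (absoluteGaloisGroup.toAlgEquiv K).injective
  rw [toAlgEquiv_absGalConjBy]
  apply AlgEquiv.ext
  intro x
  rfl

/-- **`res Γ_{K_{σv}} = σ̃_v⁻¹ (res Γ_{K_v}) σ̃_v`**: the images of the two restriction maps are exchanged by
conjugation by `σ̃_v` (`φ_v` is onto, `cd.φ_bijective`). [cite: Howard2004HeegnerKolyvagin, §1.3 (arXiv p. 7 L44–48)] [cite: NeukirchANT1999, Ch. I §9 (p. 54: G_{σ𝔓} = σ G_𝔓 σ⁻¹)] -/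
theorem range_absGaloisRestrict_smul_eq_map (cd : ConjugationDatum K) (v : HeightOneSpectrum (𝓞 K)) :
    (absGaloisRestrict K ((cd.σ • v).adicCompletion K)).toMonoidHom.range =
      (absGaloisRestrict K (v.adicCompletion K)).toMonoidHom.range.map
        (absGalConjBy ((absoluteGaloisGroup.toAlgEquiv K (cd.δ v)).toRingEquiv.trans cd.τ) (cd.σ : K ≃+* K)
          (cd.conjLift_algebraMap v)) := by
  ext t
  constructor
  · rintro ⟨g', rfl⟩
    obtain ⟨g, rfl⟩ := (cd.φ_bijective v).2 g'
    refine ⟨absGaloisRestrict K (v.adicCompletion K) g, ⟨g, rfl⟩, ?_⟩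
    exact (cd.absGaloisRestrict_φ_eq_absGalConjBy v g).symm
  · rintro ⟨_, ⟨g, rfl⟩, rfl⟩
    exact ⟨cd.φ v g, cd.absGaloisRestrict_φ_eq_absGalConjBy v g⟩

/-- **`D_{𝔓_{σv}} = σ̃_v⁻¹ D_{𝔓_v} σ̃_v`** for the primes `𝔓_w = adicCompletionPrime K w` cut out by the chosen
embeddings `K̄ → \bar K_w` (Neukirch II (9.6): `D_{𝔓_w} = res Γ_{K_w}`).
[cite: NeukirchANT1999, Ch. II §9 Prop. (9.6)] [cite: Howard2004HeegnerKolyvagin, §1.3 (arXiv p. 7 L44–48)] -/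
theorem decompositionSubgroup_adicCompletionPrime_smul_eq_map (cd : ConjugationDatum K)
    (v : HeightOneSpectrum (𝓞 K)) :
    (adicCompletionPrime K (cd.σ • v)).decompositionSubgroup (absoluteGaloisGroup K) =
      ((adicCompletionPrime K v).decompositionSubgroup (absoluteGaloisGroup K)).map
        (absGalConjBy ((absoluteGaloisGroup.toAlgEquiv K (cd.δ v)).toRingEquiv.trans cd.τ) (cd.σ : K ≃+* K)
          (cd.conjLift_algebraMap v)) := by
  rw [decompositionSubgroup_adicCompletionPrime_eq_range, decompositionSubgroup_adicCompletionPrime_eq_range]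
  exact cd.range_absGaloisRestrict_smul_eq_map v

/-! ## §2 `𝔓_{σv} = σ̃_v⁻¹ 𝔓_v` ([NSW] 12.1.3) and `φ_v(I_{K_v}) = I_{K_{σv}}` -/

/-- A maximal ideal of `\bar ℤ_K` lies in `w.primesAbove` for the finite place `w` below it. [folklore] -/
private theorem exists_mem_primesAbove_of_isMaximal (𝔓 : Ideal (absIntegers (𝓞 K) K)) [h𝔓 : 𝔓.IsMaximal] :
    ∃ w : HeightOneSpectrum (𝓞 K), 𝔓 ∈ w.primesAbove := by
  haveI : (𝔓.under (𝓞 K)).IsMaximal := Ideal.IsMaximal.under (𝓞 K) 𝔓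
  have hne : 𝔓.under (𝓞 K) ≠ ⊥ := Ring.ne_bot_of_isMaximal_of_not_isField inferInstance
    (NumberField.RingOfIntegers.not_isField K)
  exact ⟨⟨𝔓.under (𝓞 K), Ideal.IsMaximal.isPrime inferInstance, hne⟩,
    (HeightOneSpectrum.mem_primesAbove_iff).mpr ⟨h𝔓.isPrime, ⟨rfl⟩⟩⟩

-- the pointwise `MulAction` of `Γ_K` on the ideals of `\bar ℤ_K` is slow to synthesise
set_option synthInstance.maxHeartbeats 160000 in
/-- **`𝔓_{σv} = σ̃_v⁻¹ 𝔓_v`**: for every algebraic integer `x`, `x ∈ 𝔓_{σv} ↔ σ̃_v x ∈ 𝔓_v`.  Proof: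
`D_{𝔓_{σv}} = σ̃_v⁻¹ D_{𝔓_v} σ̃_v ≤ D_{σ̃_v⁻¹𝔓_v}` (§1 and `map_absGalConjBy_decompositionSubgroup_le`), and a
containment of decomposition groups of primes of `K̄` forces equality of the primes ([NSW] Cor. 12.1.3,
`eq_of_decompositionSubgroup_le`). [cite: NeukirchSchmidtWingberg2008, Cor. 12.1.3] [cite: Howard2004HeegnerKolyvagin, §1.3 (arXiv p. 7 L44–48)] -/
theorem mem_adicCompletionPrime_smul_iff (cd : ConjugationDatum K) (v : HeightOneSpectrum (𝓞 K))
    (x : absIntegers (𝓞 K) K) :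
    x ∈ adicCompletionPrime K (cd.σ • v) ↔
      (⟨((absoluteGaloisGroup.toAlgEquiv K (cd.δ v)).toRingEquiv.trans cd.τ) x,
          ringEquiv_apply_mem_absIntegers _ x.2⟩ : absIntegers (𝓞 K) K) ∈ adicCompletionPrime K v := by
  obtain ⟨𝔓', hmax, h𝔓'⟩ := exists_ideal_forall_mem_iff_apply_mem
    ((absoluteGaloisGroup.toAlgEquiv K (cd.δ v)).toRingEquiv.trans cd.τ) (adicCompletionPrime K v)
  haveI : 𝔓'.IsMaximal := hmax (adicCompletionPrime_isMaximal K v)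
  obtain ⟨w, hw⟩ := exists_mem_primesAbove_of_isMaximal 𝔓'
  have hle : (adicCompletionPrime K (cd.σ • v)).decompositionSubgroup (absoluteGaloisGroup K) ≤
      𝔓'.decompositionSubgroup (absoluteGaloisGroup K) := by
    rw [cd.decompositionSubgroup_adicCompletionPrime_smul_eq_map v]
    exact map_absGalConjBy_decompositionSubgroup_le _ _ (cd.conjLift_algebraMap v) h𝔓'
  have heq : adicCompletionPrime K (cd.σ • v) = 𝔓' :=
    eq_of_decompositionSubgroup_le K (adicCompletionPrime_mem_primesAbove K (cd.σ • v)) hw hle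
  rw [heq]
  exact h𝔓' x

/-- **`I_{𝔓_{σv}} = σ̃_v⁻¹ I_{𝔓_v} σ̃_v`** (`map_absGalConjBy_inertia_eq` at `𝔓' = 𝔓_{σv}`).
[cite: NeukirchANT1999, Ch. I §9 (9.6) (I_{σ𝔓} = σ I_𝔓 σ⁻¹)] [cite: NeukirchSchmidtWingberg2008, Cor. 12.1.3] -/
theorem inertia_adicCompletionPrime_smul_eq_map (cd : ConjugationDatum K) (v : HeightOneSpectrum (𝓞 K)) :
    (adicCompletionPrime K (cd.σ • v)).inertia (absoluteGaloisGroup K) =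
      ((adicCompletionPrime K v).inertia (absoluteGaloisGroup K)).map
        (absGalConjBy ((absoluteGaloisGroup.toAlgEquiv K (cd.δ v)).toRingEquiv.trans cd.τ) (cd.σ : K ≃+* K)
          (cd.conjLift_algebraMap v)) :=
  (map_absGalConjBy_inertia_eq _ _ (cd.conjLift_algebraMap v) (cd.mem_adicCompletionPrime_smul_iff v)).symm

/-- **`φ_v (I_{K_v}) = I_{K_{σv}}`**: the local transport of the datum maps the inertia group of `Γ_{K_v}` ONTO the
inertia group of `Γ_{K_{σv}}` (Neukirch II (9.6) `I_{𝔓_w} = res I_{K_w}` at `w = v, σv`, the previous theorem,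
`res ∘ φ_v = (σ̃_v⁻¹ · σ̃_v) ∘ res`, and injectivity of `res`).
[cite: Howard2004HeegnerKolyvagin, §1.3 (arXiv p. 7 L44–48)] [cite: NeukirchANT1999, Ch. II §9 Prop. (9.6)] -/
theorem map_φ_absInertia_eq (cd : ConjugationDatum K) (v : HeightOneSpectrum (𝓞 K)) :
    (absInertia (v.adicCompletion K)).map (cd.φ v).toMonoidHom = absInertia ((cd.σ • v).adicCompletion K) := by
  have h1 := inertia_adicCompletionPrime_eq_map_absInertia K (cd.σ • v)
  rw [cd.inertia_adicCompletionPrime_smul_eq_map v, inertia_adicCompletionPrime_eq_map_absInertia K v,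
    Subgroup.map_map] at h1
  have h2 : (absGalConjBy ((absoluteGaloisGroup.toAlgEquiv K (cd.δ v)).toRingEquiv.trans cd.τ) (cd.σ : K ≃+* K)
        (cd.conjLift_algebraMap v)).comp (absGaloisRestrict K (v.adicCompletion K)).toMonoidHom =
      (absGaloisRestrict K ((cd.σ • v).adicCompletion K)).toMonoidHom.comp (cd.φ v).toMonoidHom := by
    ext g
    exact (cd.absGaloisRestrict_φ_eq_absGalConjBy v g).symm
  rw [h2, ← Subgroup.map_map] at h1
  exact Subgroup.map_injective (absGaloisRestrict_adicCompletion_injective K (cd.σ • v)) h1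

/-- **The letter `hI`, for every conjugation datum**: `g ∈ I_{K_v} → φ_v g ∈ I_{K_{σv}}` — VERBATIM the binder `hI` of
`InertStubLocalizationTransferProofs` / `FrobeniusReadoutLagrangianTransferProofs` / `DVRSettingEngineH159Proofs`.
[cite: Howard2004HeegnerKolyvagin, §1.3 (arXiv p. 7 L44–48) with Prop. 1.5.9 (p. 10)] [cite: NeukirchANT1999, Ch. II §9 Prop. (9.6)] -/
theorem φ_mem_absInertia (cd : ConjugationDatum K) (v : HeightOneSpectrum (𝓞 K))
    {g : absoluteGaloisGroup (v.adicCompletion K)} (hg : g ∈ absInertia (v.adicCompletion K)) :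
    cd.φ v g ∈ absInertia ((cd.σ • v).adicCompletion K) := by
  rw [← cd.map_φ_absInertia_eq v]
  exact ⟨g, hg, rfl⟩

/-- `φ_v g ∈ I_{K_{σv}} ↔ g ∈ I_{K_v}` (`φ_v` is injective). [cite: Howard2004HeegnerKolyvagin, §1.3 (arXiv p. 7 L44–48)] [cite: NeukirchANT1999, Ch. II §9 Prop. (9.6)] -/
theorem φ_mem_absInertia_iff (cd : ConjugationDatum K) (v : HeightOneSpectrum (𝓞 K))
    (g : absoluteGaloisGroup (v.adicCompletion K)) :
    cd.φ v g ∈ absInertia ((cd.σ • v).adicCompletion K) ↔ g ∈ absInertia (v.adicCompletion K) := by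
  refine ⟨fun h => ?_, cd.φ_mem_absInertia v⟩
  rw [← cd.map_φ_absInertia_eq v] at h
  obtain ⟨g', hg', hgg'⟩ := h
  rwa [← (cd.φ_bijective v).1 hgg']

/-! ## §3 At a place fixed by `σ`: `φ_v` is the identity modulo inertia -/

-- the pointwise `MulAction` of `Γ_K` on the ideals of `\bar ℤ_K` is slow to synthesise
set_option synthInstance.maxHeartbeats 160000 in
/-- **`σ̃_v` FIXES `𝔓_v` when `σ • v = v`**: `x ∈ 𝔓_v ↔ σ̃_v x ∈ 𝔓_v` (both `𝔓_v` and `𝔓_{σv}` have decomposition group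
`res Γ_{K_v} = res Γ_{K_{σv}}`, so they coincide by [NSW] 12.1.3, and `𝔓_{σv} = σ̃_v⁻¹𝔓_v`).
[cite: NeukirchSchmidtWingberg2008, Cor. 12.1.3] [cite: Howard2004HeegnerKolyvagin, §1.3 (arXiv p. 7 L44–48, λ̄ = λ)] -/
theorem mem_adicCompletionPrime_iff_of_smul_eq (cd : ConjugationDatum K) {v : HeightOneSpectrum (𝓞 K)}
    (h : cd.σ • v = v) (x : absIntegers (𝓞 K) K) :
    x ∈ adicCompletionPrime K v ↔
      (⟨((absoluteGaloisGroup.toAlgEquiv K (cd.δ v)).toRingEquiv.trans cd.τ) x,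
          ringEquiv_apply_mem_absIntegers _ x.2⟩ : absIntegers (𝓞 K) K) ∈ adicCompletionPrime K v := by
  have heq : adicCompletionPrime K (cd.σ • v) = adicCompletionPrime K v := by
    refine eq_of_decompositionSubgroup_eq K (adicCompletionPrime_mem_primesAbove K (cd.σ • v))
      (adicCompletionPrime_mem_primesAbove K v) ?_
    rw [decompositionSubgroup_adicCompletionPrime_eq_range, decompositionSubgroup_adicCompletionPrime_eq_range]
    exact range_absGaloisRestrict_eq_of_eq h.symm
  rw [← cd.mem_adicCompletionPrime_smul_iff v x, heq]

/-- **`(h ▸ φ_v g) · g⁻¹ ∈ I_{K_v}` for every `g ∈ Γ_{K_v}`** at a place with `h : σ • v = v`: read in `Γ_K`,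
`res ((h ▸ φ_v g) g⁻¹) = (σ̃_v⁻¹ r σ̃_v) r⁻¹` (`r = res g ∈ D_{𝔓_v}`) lies in `I_{𝔓_v}` because conjugation by `σ̃_v`
(which fixes `𝔓_v`) is the identity on `D_{𝔓_v}/I_{𝔓_v}` (`absGalConjBy_mul_inv_mem_inertia`: the induced
automorphisms of the residue field `κ(𝔓_v)` — of finite-field type — commute); then `I_{𝔓_v} = res I_{K_v}` and
`res` is injective. [cite: Howard2004HeegnerKolyvagin, §1.3 (arXiv p. 7 L44–48) with Lemma 1.5.3 (p. 10 L12–16)] [cite: NeukirchANT1999, Ch. I §9 (9.4)–(9.6), Ch. II §9 (9.6)] -/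
theorem φ_cast_mul_inv_mem_absInertia (cd : ConjugationDatum K) {v : HeightOneSpectrum (𝓞 K)}
    (h : cd.σ • v = v) (g : absoluteGaloisGroup (v.adicCompletion K)) :
    (h ▸ cd.φ v g : absoluteGaloisGroup (v.adicCompletion K)) * g⁻¹ ∈ absInertia (v.adicCompletion K) := by
  haveI := adicCompletionPrime_isMaximal K v
  set r := absGaloisRestrict K (v.adicCompletion K) g with hr
  have hrD : r ∈ (adicCompletionPrime K v).decompositionSubgroup (absoluteGaloisGroup K) := by
    rw [decompositionSubgroup_adicCompletionPrime_eq_range]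
    exact ⟨g, rfl⟩
  have hI := absGalConjBy_mul_inv_mem_inertia ((absoluteGaloisGroup.toAlgEquiv K (cd.δ v)).toRingEquiv.trans cd.τ)
    (cd.σ : K ≃+* K) (cd.conjLift_algebraMap v) (cd.mem_adicCompletionPrime_iff_of_smul_eq h)
    (absIntegers.exists_one_lt_pow_eq_self_of_mem_primesAbove (adicCompletionPrime_mem_primesAbove K v)) hrD
  -- `res ((h ▸ φ_v g) * g⁻¹) = (σ̃⁻¹ r σ̃) * r⁻¹`
  have hres : absGaloisRestrict K (v.adicCompletion K)
      ((h ▸ cd.φ v g : absoluteGaloisGroup (v.adicCompletion K)) * g⁻¹) =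
      absGalConjBy ((absoluteGaloisGroup.toAlgEquiv K (cd.δ v)).toRingEquiv.trans cd.τ) (cd.σ : K ≃+* K)
        (cd.conjLift_algebraMap v) r * r⁻¹ := by
    rw [map_mul, map_inv, absGaloisRestrict_cast_eq' h, cd.absGaloisRestrict_φ_eq_absGalConjBy v g]
  rw [inertia_adicCompletionPrime_eq_map_absInertia K v, ← hres] at hI
  obtain ⟨i, hi, hii⟩ := hI
  rwa [← absGaloisRestrict_adicCompletion_injective K v hii]

/-- **The letter `hφI`, for every conjugation datum**: at a place with `h : σ • v = v`, for every `g ∈ Γ_{K_v}` there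
is `i ∈ I_{K_v}` with `(h ▸ φ_v g) = i * g` — VERBATIM the binder `hφI` of `InertStubLocalizationTransferProofs` /
`FrobeniusReadoutLagrangianTransferProofs` / `InertLagrangianTransferProofs` / `InertLocalPairingSymmetricProofs` /
`DVRSettingEngineH159Proofs`. [cite: Howard2004HeegnerKolyvagin, §1.3 (arXiv p. 7 L44–48) with Prop. 1.5.9 (p. 10)] [cite: NeukirchSchmidtWingberg2008, Cor. 12.1.3] -/
theorem exists_mem_absInertia_φ_cast_eq (cd : ConjugationDatum K) {v : HeightOneSpectrum (𝓞 K)}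
    (h : cd.σ • v = v) (g : absoluteGaloisGroup (v.adicCompletion K)) :
    ∃ i ∈ absInertia (v.adicCompletion K), (h ▸ cd.φ v g : absoluteGaloisGroup (v.adicCompletion K)) = i * g :=
  ⟨_, cd.φ_cast_mul_inv_mem_absInertia h g, by rw [inv_mul_cancel_right]⟩

/-- **The letter `hφγ`, for every conjugation datum**: at a place with `h : σ • v = v`, `g⁻¹ * (h ▸ φ_v g) ∈ I_{K_v}` for
every `g ∈ Γ_{K_v}` — in particular for a Frobenius lift `γ₀` («the transport preserves the Frobenius coset»),
VERBATIM the binder `hφγ` of `ResidualTau.unramified_eigen_decomposition_and_line` /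
`unramified_exists_eigenclass_ne_zero` (`InertEigenlinesProofs`). [cite: Howard2004HeegnerKolyvagin, Lemma 1.5.3 proof (arXiv p. 10 L12–16) with Prop. 1.1.7 (p. 5)] [cite: NeukirchSchmidtWingberg2008, Cor. 12.1.3] -/
theorem inv_mul_φ_cast_mem_absInertia (cd : ConjugationDatum K) {v : HeightOneSpectrum (𝓞 K)}
    (h : cd.σ • v = v) (g : absoluteGaloisGroup (v.adicCompletion K)) :
    g⁻¹ * (h ▸ cd.φ v g : absoluteGaloisGroup (v.adicCompletion K)) ∈ absInertia (v.adicCompletion K) := by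
  haveI := adicCompletionPrime_isMaximal K v
  set r := absGaloisRestrict K (v.adicCompletion K) g with hr
  have hrD : r ∈ (adicCompletionPrime K v).decompositionSubgroup (absoluteGaloisGroup K) := by
    rw [decompositionSubgroup_adicCompletionPrime_eq_range]
    exact ⟨g, rfl⟩
  have hI := inv_mul_absGalConjBy_mem_inertia ((absoluteGaloisGroup.toAlgEquiv K (cd.δ v)).toRingEquiv.trans cd.τ)
    (cd.σ : K ≃+* K) (cd.conjLift_algebraMap v) (cd.mem_adicCompletionPrime_iff_of_smul_eq h)
    (absIntegers.exists_one_lt_pow_eq_self_of_mem_primesAbove (adicCompletionPrime_mem_primesAbove K v)) hrD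
  have hres : absGaloisRestrict K (v.adicCompletion K)
      (g⁻¹ * (h ▸ cd.φ v g : absoluteGaloisGroup (v.adicCompletion K))) =
      r⁻¹ * absGalConjBy ((absoluteGaloisGroup.toAlgEquiv K (cd.δ v)).toRingEquiv.trans cd.τ) (cd.σ : K ≃+* K)
        (cd.conjLift_algebraMap v) r := by
    rw [map_mul, map_inv, absGaloisRestrict_cast_eq' h, cd.absGaloisRestrict_φ_eq_absGalConjBy v g]
  rw [inertia_adicCompletionPrime_eq_map_absInertia K v, ← hres] at hI
  obtain ⟨i, hi, hii⟩ := hI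
  rwa [← absGaloisRestrict_adicCompletion_injective K v hii]

end ConjugationDatum

end Literature.NumberTheory.GaloisCohomology.Howard2004

end
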